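import Literature.Probability.Percolation.ArmSeparationOuterFail
import HarnessLib

/-!
# The surgery step for the external extremities

Topic: Probability / Percolation; family `crit-perc`. A brick of the discharge of
`Literature.Probability.Percolation.Nolin2008_twoArm_separation` (Nolin 2008, Thm. 11
[arXiv 0711.4948: Thm. 10]; `ArmSeparation.lean`): the probabilistic form of the first step of
Nolin's §4.4 for the OUTER extremities of the two-arm event `armEvent ![true,false] n (2M)`,
assembled from `ArmSeparationOuter.lean` (on `OutGood`, both arms are fenced behind some sides
of `∂Λ_{2M}`: `exists_two_trapFencedArm`) and `ArmSeparationOuterFail.lean` (the failure event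
`¬ OutGood` is unlikely, lives outside `Λ_M`, and is independent of events of `Λ_M`):

* `OutTinyExt M n k₀ K` — **the tiny extension exists**: in some rotated frame the open arm is
  fenced (`TrapFencedArm … (rotConfig io ω)`) and in some rotated, colour-exchanged frame the
  closed arm is fenced.
* `armEvent_subset_outTinyExt_union` —
  `A(n, 2M) ⊆ OutTinyExt ∪ ({¬ OutGood} ∩ A(n, M))`.
* `real_armEvent_le_out_step` — **the step inequality**
  `P(A(n,2M)) ≤ P(OutTinyExt M n k₀ K) + P(¬ OutGood M T k₀ K) · P(A(n, M))`
  (union bound, then independence of `{¬ OutGood}` — determined outside `Λ_M` — from `A(n, M)`,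
  determined by `Λ_M`).

## References

* P. Nolin, *Near-critical percolation in two dimensions*, Electron. J. Probab. 13 (2008), §4.4,
  proof of Thm. 11, first display [arXiv 0711.4948: Thm. 10]. [Nolin2008]
* H. Kesten, *Scaling relations for 2D-percolation*, Comm. Math. Phys. 109 (1987), Lemma 2. [Kesten1987]
-/

noncomputable section

open Set MeasureTheory

namespace Literature.Probability.Percolation

open LatticeModels

/-- **The tiny extension of the outer extremities exists**: the open arm is fenced behind side
`0` of some rotated frame and the closed arm behind side `0` of some rotated, colour-exchanged
frame (Nolin's `Ã^{·/η'}(n, 2M)` before landing). [cite: Nolin2008, §4.4 (arXiv 0711.4948: proof of Thm. 10, first display)] -/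
def OutTinyExt (M n k₀ K : ℕ) : Set (SiteConfig (Site 2)) :=
  {ω | ∃ io < 6, ∃ ic < 6, Nonempty (TrapFencedArm M n k₀ K (rotConfig io ω)) ∧
    Nonempty (TrapFencedArm M n k₀ K (rotConfig ic ω)ᶜ)}

/-- **The deterministic step**: `A(n, 2M) ⊆ OutTinyExt ∪ ({¬ OutGood} ∩ A(n, M))` (`1 ≤ M`,
`n ≤ M`). [cite: Nolin2008, §4.4 (arXiv 0711.4948: proof of Thm. 10, first display)] -/
theorem armEvent_subset_outTinyExt_union {M n : ℕ} (hM : 1 ≤ M) (hnM : n ≤ M) (T k₀ K : ℕ) :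
    armEvent ![true, false] n (2 * M) ⊆
      OutTinyExt M n k₀ K ∪ ({ω | ¬ OutGood M T k₀ K ω} ∩ armEvent ![true, false] n M) := by
  intro ω hω
  by_cases hg : OutGood M T k₀ K ω
  · obtain ⟨io, hio, ic, hic, hFo, hFc⟩ := exists_two_trapFencedArm hM hnM hg hω
    exact Or.inl ⟨io, hio, ic, hic, hFo, hFc⟩
  · exact Or.inr ⟨hg, armEvent_mono_holds _ hnM (by omega) hω⟩

/-- **The step inequality for the outer extremities**:
`P(A(n, 2M)) ≤ P(OutTinyExt M n k₀ K) + P(¬ OutGood M T k₀ K) · P(A(n, M))`. [cite: Nolin2008, §4.4 (arXiv 0711.4948: proof of Thm. 10, first display); Kesten1987, Lemma 2] -/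
theorem real_armEvent_le_out_step {M n T k₀ K : ℕ} (hM : 2 ≤ M) (hnM : n ≤ M)
    (hKM : ∀ j < K, 2 * trapScale k₀ j + 2 ≤ M) :
    (triSitePercolation half).real (armEvent ![true, false] n (2 * M)) ≤
      (triSitePercolation half).real (OutTinyExt M n k₀ K) +
        (triSitePercolation half).real {ω | ¬ OutGood M T k₀ K ω} *
          (triSitePercolation half).real (armEvent ![true, false] n M) := by
  have hsub := armEvent_subset_outTinyExt_union (le_trans (by norm_num) hM) hnM T k₀ K
  have hA : DeterminedBy (armEvent ![true, false] n M) ↑(triBall M) :=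
    (determinedBy_armEvent _ hnM).mono (Finset.coe_subset.2 (Finset.filter_subset _ _))
  have hind := real_inter_setOf_not_outGood (T := T) (k₀ := k₀) (K := K) (R := M - 1) (le_trans (by norm_num) hM)
    (fun j hj => by have := hKM j hj; omega) (by omega) hA
  calc (triSitePercolation half).real (armEvent ![true, false] n (2 * M))
      ≤ (triSitePercolation half).real (OutTinyExt M n k₀ K ∪ ({ω | ¬ OutGood M T k₀ K ω} ∩ armEvent ![true, false] n M)) :=
        measureReal_mono hsub (measure_ne_top _ _)
    _ ≤ (triSitePercolation half).real (OutTinyExt M n k₀ K) +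
          (triSitePercolation half).real ({ω | ¬ OutGood M T k₀ K ω} ∩ armEvent ![true, false] n M) :=
        measureReal_union_le _ _
    _ = _ := by rw [Set.inter_comm, hind, mul_comm]

end Literature.Probability.Percolation
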